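import Summits.ABC.IUTFork.Cor312BridgeHypsDHVolArch
import HarnessLib

/-!
# [IUTchIII] Corollary 3.12, statement — NON-VACUITY of the box interface of `Real.settingDHVolArch`: the model
# boxes (Step (vii) container at `∞`, unit polydisc at every prime)

Record-only file (D-0012) of the abc-iut cell (wave-5 prover seat abc-iut-w5-d163 gen 2; TEAM A row A-0 NAMED
LEFTOVER (4) «archimedean radial container vs DH convention», sequel of `Cor312BridgeHypsDHVolArch`); TAKES NO SIDE
on [IUTchIII] Cor. 3.12. The archimedean twin of abc-iut-c312-5's `bridgeHyps_settingDHVol_unitBoxes`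
(`Cor312BridgeHypsDHVolHullSets` §3), at the assembled real setting with the verbatim container at the primes and
abc-iut-L5-t7's radial/angular log-volume on `M_I` at `∞` ([IUTchIV] Prop. 1.5 (iii)/(iv), Thm. 1.10 Step (vii),
kurims `paper:url-56bcb0f95768` p. 30):

* `archModelBoxes` — the MODEL Θ-boxes: the Step (vii) container `Φ₀(π^{j+1}·B_I)` (polydisc of radius `π^{j+1}` of
  `⊕_{(w,ε)} ℂ`) at `∞`, the unit polydisc `𝒪_L` at every prime; `archContainer_eq_hullSet` (the container is the
  hull-set `λ·𝒪`, `λ = Φ₀(⊗_i (π)_v)`), `isHullSet_archModelBoxes`;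
* **`bridgeHyps_settingDHVolArch_modelBoxes`** — with the model boxes EVERY field of c312-6's
  `BridgeHyps (Real.settingDHVolArch …)` HOLDS, for any values of the context binders;
* `thetaLocal_settingDHVolArch_modelBoxes_inl` / `_inr` — the local Θ-volumes are then `|S^±_{j+1}|·log π = (j+1)·log π`
  at `∞` and `0` at every good prime (`p > 2`, `p ∤ disc(F)`);
* `statement_settingDHVolArch_modelBoxes_of_globalVolumeTransport` — and the printed Statement follows from TEAM B's
  GLOBAL B-INPUT alone (GAP-LEDGER G-c312-11-1 family; NOT asserted).
A witness for the INTERFACE (the binder `thetaBox` CAN be instantiated so that all side conditions hold with the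
honest archimedean term present); NOT a statement about the Θ-pilot object of [IUTchIII] Def. 3.8 (i).
[claim: Mochizuki2012, status: disputed] for the quoted sentences; the mathematics is classical.
-/

noncomputable section

open Set Function NumberField IsDedekindDomain Bornology
open scoped Pointwise

namespace Summit.ABC

namespace IUTFork

namespace Thm311

namespace Real

open Cor312 Cor312Vol Literature.IUT.LogThetaLattice Literature.IUT.LogVolume Literature.IUT.LogVolume.Prop15iii
  PiTensorProduct


variable {F : Type} [Field F] [NumberField F] (X : PilotData F) {logv : PadicLogs F} (hlog : LogvAnalytic logv)
  (hc : ∀ w : InfinitePlace F, w.IsComplex)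

section Setting

variable (M : Type) [Field M] [NumberField M]
  (archPk : ∀ (j : (thetaIndex X).Label) (vQ : (thetaIndex X).VQ), Set ((logShellsDH X logv).Packet j vQ))
  (archSub : ∀ (j : (thetaIndex X).Label) (v : (thetaIndex X).V),
    Set ((logShellsDH X logv).Packet j ((thetaIndex X).over v)))
  (Ψ : ℤ → ∀ v : (thetaIndex X).V, v ∈ (thetaIndex X).Vbad → Set ((logShellsDH X logv).StarPacket v))
  (act : ℤ → ∀ v : (thetaIndex X).V, v ∈ (thetaIndex X).Vbad →
    (logShellsDH X logv).StarPacket v → Module.End ℚ ((logShellsDH X logv).StarPacket v))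
  (Mmod : ℤ → ∀ j : (thetaIndex X).LabelStar, Set ((logShellsDH X logv).GlobalPacket j.1))
  (region : ℤ → ∀ j : (thetaIndex X).LabelStar, FinDivisor M → ∀ vQ : (thetaIndex X).VQ,
    Set ((logShellsDH X logv).Packet j.1 vQ))
  (n : ℤ) {HT : Type} {LogLink : HT → HT → Type} {IsFull : ∀ {s t : HT}, LogLink s t → Prop}
  (lat : LGPGaussianLogThetaLattice LogLink IsFull)
  {Frd : Type} {IsoF : Frd → Frd → Type} {Ob : Frd → Type} {realify : Frd → Frd} {Strip : Type}
  {IsoS : Strip → Strip → Type} {Mv : ∀ v : (thetaIndex X).V, v ∈ (thetaIndex X).Vbad → Type}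
  [∀ v h, Monoid (Mv v h)]
  (sig : GlobalLGPFrobenioidSignature (thetaIndex X).lstar (thetaIndex X).V (· ∈ (thetaIndex X).Vbad)
    Frd IsoF Ob realify Strip IsoS Mv)
  (split : SplittingMonoids Mv) {ObΔ : Type} {N : ∀ v : (thetaIndex X).V, v ∈ (thetaIndex X).Vbad → Type}
  [∀ v h, Monoid (N v h)] (qData : QPilotData ObΔ N)
  (thetaBox : ℤ → Ob sig.Clgp → ∀ (j : (thetaIndex X).Label) (vQ : (thetaIndex X).VQ),
    Set (∀ s : factorIdxDHArch X hlog j vQ, factorFieldDHArch X hlog j vQ s))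
  (qCentre : ObΔ → ∀ (j : (thetaIndex X).Label) (vQ : (thetaIndex X).VQ),
    ∀ s : factorIdxDHArch X hlog j vQ, factorFieldDHArch X hlog j vQ s)
  (hq : ∀ j vQ s, qCentre (qPilotObject qData) j vQ s ≠ 0)
  (hfin : ∀ j : (thetaIndex X).Label, (Function.support fun vQ =>
    ((situationDHVolArch X hlog hc M archPk archSub Ψ act Mmod region).D n).logvol j vQ
      (factorMapDHArch X hlog hc j vQ ⁻¹' hullSet (factorFieldDHArch X hlog j vQ)
        (qCentre (qPilotObject qData) j vQ))).Finite)

/-! ## The model boxes and the witness -/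

/-- The MODEL Θ-boxes: the Step (vii) container `Φ₀(π^{j+1}·B_I)` at `∞`, the unit polydisc `𝒪_L` at every prime.
A witness for the interface; NOT the boxes of the Θ-pilot object of [IUTchIII] Def. 3.8 (i). [folklore] -/
def archModelBoxes : ∀ (j : (thetaIndex X).Label) (vQ : (thetaIndex X).VQ),
    Set (∀ s : factorIdxDHArch X hlog j vQ, factorFieldDHArch X hlog j vQ s)
  | j, .inl _ => archContainer X hlog j
  | j, .inr pp => hullSet (factorFieldDHArch X hlog j (.inr pp)) (fun _ => 1)

/-- The Step (vii) container is the hull-set `λ·𝒪` of `⊕_{(w,ε)} ℂ` with `λ = Φ₀(⊗_i (π)_v)` (all coordinates of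
norm `π^{j+1}`). [folklore] -/
theorem archContainer_eq_hullSet (j : (thetaIndex X).Label) :
    archContainer X hlog j = hullSet (factorFieldDHArch X hlog j (.inl ())) (archMaxPoint X hlog j) := by
  ext x
  exact (mem_polydisc _).trans
    ((forall_congr' fun s => by rw [norm_archMaxPoint]; exact Iff.rfl).trans (mem_polydisc _).symm)

/-- Every model box is a hull-set. [folklore] -/
theorem isHullSet_archModelBoxes (j : (thetaIndex X).Label) :
    ∀ vQ : (thetaIndex X).VQ, IsHullSet (factorFieldDHArch X hlog j vQ) (archModelBoxes X hlog j vQ)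
  | .inl u => by
    cases u
    exact ⟨archMaxPoint X hlog j, fun s => by
      rw [← norm_ne_zero_iff, norm_archMaxPoint]
      exact (pow_pos Real.pi_pos _).ne', archContainer_eq_hullSet X hlog j⟩
  | .inr _ => ⟨fun _ => 1, fun _ => one_ne_zero, rfl⟩

/-- **NON-VACUITY WITNESS: with the model boxes, `BridgeHyps (Real.settingDHVolArch …)` HOLDS** for any values of
the context binders — archimedean place honest. [folklore] -/
theorem bridgeHyps_settingDHVolArch_modelBoxes :
    BridgeHyps (settingDHVolArch X hlog hc M archPk archSub Ψ act Mmod region n lat sig split qData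
      (fun (_ : ℤ) (_ : Ob sig.Clgp) => archModelBoxes X hlog) qCentre hq hfin) := by
  refine bridgeHyps_settingDHVolArch_of_hullSets X hlog hc M archPk archSub Ψ act Mmod region n lat sig split qData
    qCentre hq hfin (fun i => ?_) (fun i pp => ?_) (fun i => ?_)
  · rw [Set.iUnion_const]
    rfl
  · rw [Set.iUnion_const]
    exact ⟨fun _ => 1, fun _ => one_ne_zero, rfl⟩
  · refine Set.finite_empty.subset fun pp hpp => ?_
    exact hpp (by rw [Set.iUnion_const]; rfl)

/-- With the model boxes the archimedean local Θ-volume IS `|S^±_{j+1}|·log π = (j+1)·log π`. [folklore] -/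
theorem thetaLocal_settingDHVolArch_modelBoxes_inl (j : (thetaIndex X).Label) :
    (settingDHVolArch X hlog hc M archPk archSub Ψ act Mmod region n lat sig split qData
        (fun (_ : ℤ) (_ : Ob sig.Clgp) => archModelBoxes X hlog) qCentre hq hfin).thetaLocal j (.inl ()) =
      ((Fintype.card ((thetaIndex X).Caps j) * Real.log Real.pi : ℝ) : WithTop ℝ) :=
  thetaLocal_settingDHVolArch_inl_of_eq X hlog hc M archPk archSub Ψ act Mmod region n lat sig split qData qCentre hq
    hfin j (by rw [Set.iUnion_const]; rfl)

/-- … and the local Θ-volume at every good prime (`p > 2`, `p ∤ disc(F)`, `j ∈ 𝔽_l^⋇`) is `0`. [folklore] -/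
theorem thetaLocal_settingDHVolArch_modelBoxes_inr (i : Fin (thetaIndex X).lstar) (pp : Nat.Primes)
    (hp2 : 2 < (pp : ℕ)) (hdisc : ¬ ((pp : ℕ) : ℤ) ∣ NumberField.discr F) :
    (settingDHVolArch X hlog hc M archPk archSub Ψ act Mmod region n lat sig split qData
        (fun (_ : ℤ) (_ : Ob sig.Clgp) => archModelBoxes X hlog) qCentre hq hfin).thetaLocal (Setting.labelSucc i)
        (.inr pp) = ((0 : ℝ) : WithTop ℝ) :=
  thetaLocal_settingDHVolArch_eq_zero X hlog hc M archPk archSub Ψ act Mmod region n lat sig split qData _ qCentre hq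
    hfin i pp hp2 hdisc (by rw [Set.iUnion_const]; rfl)

/-- With the model boxes the printed Statement follows from the GLOBAL B-INPUT ALONE (every other input of TEAM
B's route discharged at this setting). [claim: Mochizuki2012, status: disputed] -/
theorem statement_settingDHVolArch_modelBoxes_of_globalVolumeTransport
    (hgvt : GlobalVolumeTransport (settingDHVolArch X hlog hc M archPk archSub Ψ act Mmod region n lat sig split qData
      (fun (_ : ℤ) (_ : Ob sig.Clgp) => archModelBoxes X hlog) qCentre hq hfin)) :
    (settingDHVolArch X hlog hc M archPk archSub Ψ act Mmod region n lat sig split qData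
      (fun (_ : ℤ) (_ : Ob sig.Clgp) => archModelBoxes X hlog) qCentre hq hfin).Statement := by
  refine statement_settingDHVolArch_of_globalVolumeTransport_of_hullSets X hlog hc M archPk archSub Ψ act Mmod
    region n lat sig split qData qCentre hq hfin (fun _ i vQ => isHullSet_archModelBoxes X hlog _ vQ) (fun i => ?_)
    (fun i pp => ?_) (fun i => ?_) hgvt
  · rw [Set.iUnion_const]
    rfl
  · rw [Set.iUnion_const]
    exact ⟨fun _ => 1, fun _ => one_ne_zero, rfl⟩
  · refine Set.finite_empty.subset fun pp hpp => ?_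
    exact hpp (by rw [Set.iUnion_const]; rfl)

end Setting

end Real

end Thm311

end IUTFork

end Summit.ABC

end
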